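import Mathlib.Analysis.SpecialFunctions.Log.Basic
import Literature.IUT.HodgeArakelov.GoodPrimeFrobenioidMonoids
import HarnessLib

/-!
# [IUTchII] Prop 4.2 (ii) / Prop 4.4 (ii): the realified rank-one monoid `ℝ_{≥0}(−)` with its distinguished
# element is INHABITED — non-vacuity witness for the interface `PointedHalfLine` (NV-L6 wave)

S. Mochizuki, *Inter-universal Teichmüller theory II*, §4, Prop 4.2 (ii) (kurims p. 124: "`Ψ^R_cns(†G_v)` …
the distinguished element … determined by `log^{†G_v}(p_v)`") and Prop 4.4 (ii) (p. 130: archimedean `v`,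
"`p_v = e = 2.71828…`") [cite: Mochizuki2012, Prop 4.2 (ii) p.124] [claim: Mochizuki2012, status: disputed].

PROOF-ONLY non-vacuity file (abc-iut cell, wave-4 prover abc-iut-w4-d098, L6-lead §F v1.18p row call
«NV-L6 WAVE»; interface of abc-iut-L6-t5's `GoodPrimeFrobenioidMonoids.lean`, which records the printed
realified monoid AS `ℝ≥0` with a positive distinguished element).  GENUINE models, built inside the
theorem terms (no `def`/`instance`/`structure` declared here):

* `PointedHalfLine.nonempty_model` — the archimedean model of Prop 4.4 (ii): distinguished element
  `log(p_v) = log e = 1`;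
* `PointedHalfLine.exists_pt_eq_log` — the nonarchimedean model of Prop 4.2 (ii) at any prime `p`:
  distinguished element `log(p) > 0`.

Nothing here takes a side on [IUTchIII] Cor. 3.12; a non-vacuity witness asserts only that the interface is
consistent and is met by the printed data.
-/

namespace Literature.IUT.HodgeArakelov

open scoped NNReal

/-- **Non-vacuity, archimedean model** ([IUTchII] Prop 4.4 (ii) p. 130: the distinguished element of
`ℝ_{≥0}(†D^⊢_v)` is `log^{†D^⊢_v}(p_v)` with `p_v = e`, i.e. `1`). GENUINE model.
[cite: Mochizuki2012, Prop 4.4 (ii) p.130] -/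
theorem PointedHalfLine.nonempty_model : Nonempty PointedHalfLine :=
  ⟨{ pt := 1, pt_pos := one_pos }⟩

/-- **Non-vacuity, nonarchimedean model at a prime `p`** ([IUTchII] Prop 4.2 (ii) p. 124: the distinguished
element of `Ψ^R_cns(†G_v) ⥲ ℝ_{≥0}(†G_v)` is `log^{†G_v}(p_v)`): there is a `PointedHalfLine` whose
distinguished element is `log p` (positive since `p ≥ 2`). GENUINE model. [cite: Mochizuki2012, Prop 4.2 (ii) p.124] -/
theorem PointedHalfLine.exists_pt_eq_log (p : ℕ) [hp : Fact p.Prime] :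
    ∃ A : PointedHalfLine, (A.pt : ℝ) = Real.log p := by
  have hlog : 0 < Real.log p := Real.log_pos (by exact_mod_cast hp.out.one_lt)
  exact ⟨{ pt := ⟨Real.log p, hlog.le⟩, pt_pos := hlog }, rfl⟩

/-- The two models are related by the scaling isomorphism of the interface (`PointedHalfLine.scaleIso`,
Prop 4.2 (ii) "a unique isomorphism of monoids … that maps the distinguished element … to the distinguished
element"): for every prime `p` the model with distinguished element `log p` is carried onto the archimedean
model. [cite: Mochizuki2012, Prop 4.2 (ii) p.124] -/
theorem PointedHalfLine.exists_scaleIso_log_to_one (p : ℕ) [Fact p.Prime] :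
    ∃ A B : PointedHalfLine, (A.pt : ℝ) = Real.log p ∧ B.pt = 1 ∧ PointedHalfLine.scaleIso A B A.pt = B.pt := by
  obtain ⟨A, hA⟩ := PointedHalfLine.exists_pt_eq_log p
  exact ⟨A, { pt := 1, pt_pos := one_pos }, hA, rfl, PointedHalfLine.scaleIso_pt A _⟩

end Literature.IUT.HodgeArakelov
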